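import Summits.Ventures.YMGap.Census.OneLinkConfiguration
import Summits.Ventures.YMGap.Census.CoeffMonotone
import Summits.Ventures.YMGap.Census.DecimationLowerBound
import Summits.Ventures.LatticeQCDFlow.Scoring.ProductHaarSlices
import Summits.Ventures.LatticeQCDFlow.Exactness.CompactHaar
import HarnessLib

/-!
# Venture YMGap, track (b) census — the AXIAL-GAUGE PLAQUETTE FOREST of the torus `(ℤ/Lℤ)^d`: a set of
# `(d-1)L^d - (L + ⋯ + L^{d-1})` plaquettes whose plaquette functions integrate to `1` exactly, and the resulting
# sup bound `Z_Λ({c_j}) ≤ f_c(1)^{#plaquettes - #forest}` on the positivity domain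

HONEST FRAMING: venture file of the cell `pub-ymgap` (QuantumFields programme), track (b); exact statements about the
finite tori `(ℤ/Lℤ)^d`, `L ≥ 2`, in the vocabulary of `TomboulisVortexDecimation`; nothing about (5.15), limits,
confinement or a mass gap.  PURPOSE: the input replacing the crude sup bound `Z_Λ ≤ f(1)^{#plaquettes}` of Tomboulis's
App. A §3 (arXiv:0707.2179; tree: `DecimationLowerBound.torusZ_le_pow_card`) in the proof of Prop. III.2 / IV.4 for the
decimation parameter `b = 2` in `d = 3, 4, 5` (`DecimationLowerBoundTwo`).

* `plaqEdges p` — the four links of a plaquette; `plaquetteHolonomy_update_of_notMem`.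
* `axialForest d L` — the plaquettes `p = (x; μ < ν)` with `x_λ = 0` for all `λ < μ` and `x_μ ≠ L - 1`;
  `privEdge p = (x + e_μ, ν)` (the far rung), `forestRank p = μ·L + (L - 1 - x_μ)`.
* `forestRank_lt_of_privEdge_mem` — THE COMBINATORIAL FACT: if the private link of a forest member `p` is a link of
  another forest member `q`, then `q` has strictly smaller rank (so, peeling the forest in increasing rank, each member's
  private link is seen by no remaining member).
* `integral_plaqFn_hol_mul` — one Haar integration: `∫ f_c(U_p)·P dU = ∫ P dU` when `P` does not read `privEdge p`
  (left/right invariance of Haar measure on `SU(2)` and `∫ f_c dHaar = 1`); ANY real coefficient vector `c`.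
* **`integral_prod_axialForest`** — `∫ ∏_{p ∈ 𝔉} f_c(U_p) dU = 1` for the forest `𝔉` and every `c`
  (`Finset.induction_on_min_value` on the rank); more generally for every subset of `𝔉`.
* **`torusZ_le_pow_card_sub_card_forest`** — for `c_j ≥ 0` with `f_c ≥ 0` pointwise:
  `Z_Λ({c_j}) ≤ [1 + Σ_j d_j² c_j]^{#plaquettes - #𝔉}`.

The count `#𝔉 ≥ (d-1)(L^d - L^{d-1}) + (d-2)(L^{d-1} - L^{d-2})` and the assembly of III.2 / IV.4 are in
`DecimationLowerBoundTwo`.  References: E. T. Tomboulis, arXiv:0707.2179, Prop. III.2 eq. (3.7), App. A §3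
[cite: Tomboulis2007Confinement, App. A §3]; the axial-gauge / maximal-tree device is standard lattice gauge theory
(e.g. J.-M. Drouffe, J.-B. Zuber, Phys. Rept. 102 (1983) 1, §2.2) [folklore].
-/

noncomputable section

open MeasureTheory Finset Real Function
open scoped BigOperators
open Literature.MathematicalPhysics.QuantumLattice
open Literature.MathematicalPhysics.QuantumFieldTheory
open Literature.MathematicalPhysics.QuantumFieldTheory.Tomboulis2007
open Literature.MathematicalPhysics.QuantumFieldTheory.WilsonRP
open Summit.Ventures.LatticeQCDFlow.Exactness
open Summit.Ventures.LatticeQCDFlow.Scoring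

namespace Summit.Ventures.YMGap.Census

variable {d L : ℕ}

/-! ### The four links of a plaquette -/

/-- The links of the plaquette `p = (x; i < j)`: `(x, i)`, `(x + e_i, j)`, `(x + e_j, i)`, `(x, j)` — exactly the links read
by `plaquetteHolonomy U x i j = U(x,i) U(x+e_i,j) U(x+e_j,i)⁻¹ U(x,j)⁻¹`. -/
def plaqEdges (p : Plaquette d L) : Finset (Edge d L) :=
  {(p.1, p.2.1.1), (p.1.shift p.2.1.1, p.2.1.2), (p.1.shift p.2.1.2, p.2.1.1), (p.1, p.2.1.2)}

/-- Updating a link outside `plaqEdges p` does not move `U_p`. -/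
theorem plaquetteHolonomy_update_of_notMem {G : Type*} [Group G] (U : GaugeConfig d L G) {e : Edge d L} (g : G)
    {p : Plaquette d L} (he : e ∉ plaqEdges p) :
    plaquetteHolonomy (update U e g) p.1 p.2.1.1 p.2.1.2 = plaquetteHolonomy U p.1 p.2.1.1 p.2.1.2 := by
  simp only [plaqEdges, mem_insert, mem_singleton, not_or] at he
  obtain ⟨h1, h2, h3, h4⟩ := he
  unfold plaquetteHolonomy
  rw [update_of_ne (Ne.symm h1), update_of_ne (Ne.symm h2), update_of_ne (Ne.symm h3), update_of_ne (Ne.symm h4)]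

/-- The private link of `p = (x; i < j)`: the far rung `(x + e_i, j)`. -/
def privEdge (p : Plaquette d L) : Edge d L := (p.1.shift p.2.1.1, p.2.1.2)

/-- The private link is a link of the plaquette. -/
theorem privEdge_mem_plaqEdges (p : Plaquette d L) : privEdge p ∈ plaqEdges p := by
  simp [privEdge, plaqEdges]

/-- `x ↦ x + e_i` is injective. -/
theorem shift_injective' (i : Fin d) {x y : Site d L} (h : x.shift i = y.shift i) : x = y := by
  unfold Site.shift at h
  exact add_right_cancel h

/-! ### The axial-gauge forest, its rank, and the combinatorial fact -/

variable [NeZero L]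

/-- **The axial-gauge plaquette forest** of `(ℤ/Lℤ)^d`: the plaquettes `(x; μ < ν)` whose base point has `x_λ = 0` for
every `λ < μ` and `x_μ ≠ L - 1` (i.e. `x_μ + 1 ≠ 0` in `ℤ/L`). -/
def axialForest (d L : ℕ) [NeZero L] : Finset (Plaquette d L) :=
  univ.filter fun p => (∀ k : Fin d, k < p.2.1.1 → p.1 k = 0) ∧ p.1 p.2.1.1 + 1 ≠ 0

/-- Membership in the forest, unfolded. -/
theorem mem_axialForest {p : Plaquette d L} :
    p ∈ axialForest d L ↔ (∀ k : Fin d, k < p.2.1.1 → p.1 k = 0) ∧ p.1 p.2.1.1 + 1 ≠ 0 := by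
  simp [axialForest]

/-- The peeling rank `μ·L + (L - 1 - x_μ)` of `p = (x; μ < ν)`: smaller rank is peeled first (first plane direction
ascending, then `x_μ` descending). -/
def forestRank (p : Plaquette d L) : ℕ := (p.2.1.1 : ℕ) * L + (L - 1 - (p.1 p.2.1.1).val)

/-- In `ℤ/L`: if `a + 1 ≠ 0` then `val (a + 1) = val a + 1 < L`. -/
theorem val_add_one_of_ne [Fact (1 < L)] {a : ZMod L} (h : a + 1 ≠ 0) : (a + 1).val = a.val + 1 ∧ a.val + 1 < L := by
  have hlt : a.val < L := ZMod.val_lt a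
  have hcast : ((a.val + 1 : ℕ) : ZMod L) = a + 1 := by
    push_cast
    rw [ZMod.natCast_zmod_val]
  by_cases h' : a.val + 1 < L
  · refine ⟨?_, h'⟩
    rw [← hcast, ZMod.val_natCast, Nat.mod_eq_of_lt h']
  · exfalso
    have hL : a.val + 1 = L := by omega
    rw [hL, ZMod.natCast_self] at hcast
    exact h hcast.symm

/-- The rank of `(y; i' < j')` is below `(i' + 1)·L`. -/
theorem forestRank_lt_succ_mul (q : Plaquette d L) : forestRank q < ((q.2.1.1 : ℕ) + 1) * L := by
  unfold forestRank
  have hL : 1 ≤ L := Nat.one_le_iff_ne_zero.2 (NeZero.ne L)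
  have : L - 1 - (q.1 q.2.1.1).val < L := by omega
  nlinarith

omit [NeZero L] in
/-- The rank of `(x; i < j)` is at least `i·L`. -/
theorem mul_le_forestRank (p : Plaquette d L) : (p.2.1.1 : ℕ) * L ≤ forestRank p := by
  unfold forestRank
  exact Nat.le_add_right _ _

/-- Ranks compare like first plane directions when these differ. -/
theorem forestRank_lt_of_fst_lt {p q : Plaquette d L} (h : q.2.1.1 < p.2.1.1) : forestRank q < forestRank p := by
  refine lt_of_lt_of_le (forestRank_lt_succ_mul q) (le_trans ?_ (mul_le_forestRank p))
  exact Nat.mul_le_mul_right _ (by have := Fin.lt_def.1 h; omega)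

/-- **The combinatorial fact.**  If the private link of a forest member `p` is a link of a different forest member `q`,
then `q` is peeled before `p`. -/
theorem forestRank_lt_of_privEdge_mem [Fact (1 < L)] {p q : Plaquette d L} (hp : p ∈ axialForest d L)
    (hq : q ∈ axialForest d L) (hne : q ≠ p) (he : privEdge p ∈ plaqEdges q) : forestRank q < forestRank p := by
  obtain ⟨x, ⟨⟨i, j⟩, hij⟩⟩ := p
  obtain ⟨y, ⟨⟨i', j'⟩, hij'⟩⟩ := q
  rw [mem_axialForest] at hp hq
  simp only at hp hq hij hij' hne ⊢
  obtain ⟨hp1, hp2⟩ := hp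
  obtain ⟨hq1, hq2⟩ := hq
  have hxi : x.shift i i = x i + 1 := shift_apply_self x i
  simp only [privEdge, plaqEdges, mem_insert, mem_singleton, Prod.mk.injEq] at he
  rcases he with ⟨h1, h2⟩ | ⟨h1, h2⟩ | ⟨h1, h2⟩ | ⟨h1, h2⟩
  · -- `(x + e_i, j) = (y, i')`: then `i < j = i'` and `y_i = x_i + 1 ≠ 0`, contradicting `q ∈ 𝔉`
    exfalso
    subst h2
    have := hq1 i hij
    rw [← h1, hxi] at this
    exact hp2 this
  · -- `(x + e_i, j) = (y + e_{i'}, j')`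
    subst h2
    rcases lt_trichotomy i i' with hlt | heq | hgt
    · exfalso
      have hy : y i = x i + 1 := by rw [← shift_apply_of_ne y (ne_of_lt hlt), ← h1, hxi]
      exact hp2 (hy ▸ hq1 i hlt)
    · exfalso
      subst heq
      have hxy : x = y := shift_injective' i h1
      subst hxy
      exact hne rfl
    · exact forestRank_lt_of_fst_lt hgt
  · -- `(x + e_i, j) = (y + e_{j'}, i')`: then `i < j = i' < j'`
    exfalso
    subst h2
    have hij2 : i < j' := lt_trans hij hij'
    have hy : y i = x i + 1 := by rw [← shift_apply_of_ne y (ne_of_lt hij2), ← h1, hxi]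
    exact hp2 (hy ▸ hq1 i hij)
  · -- `(x + e_i, j) = (y, j')`
    subst h2
    rcases lt_trichotomy i i' with hlt | heq | hgt
    · exfalso
      have hy : y i = x i + 1 := by rw [← h1, hxi]
      exact hp2 (hy ▸ hq1 i hlt)
    · subst heq
      subst h1
      unfold forestRank
      simp only
      rw [hxi, (val_add_one_of_ne hp2).1]
      have := (val_add_one_of_ne hp2).2
      omega
    · exact forestRank_lt_of_fst_lt hgt

/-! ### One Haar integration -/

section Peel

variable [Fact (1 < L)]

omit [NeZero L] in
/-- At the private link: `U_p(W[e ↦ g]) = W(x,i) · g · (W(x+e_j,i)⁻¹ W(x,j)⁻¹)`. -/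
theorem plaquetteHolonomy_update_privEdge (W : GaugeConfig d L SU2) (p : Plaquette d L) (g : SU2) :
    plaquetteHolonomy (update W (privEdge p) g) p.1 p.2.1.1 p.2.1.2 =
      W (p.1, p.2.1.1) * g * ((W (p.1.shift p.2.1.2, p.2.1.1))⁻¹ * (W (p.1, p.2.1.2))⁻¹) := by
  have hij : p.2.1.1 ≠ p.2.1.2 := ne_of_lt p.2.2
  have h1 : (p.1, p.2.1.1) ≠ privEdge p := fun h => hij (Prod.ext_iff.1 h).2
  have h3 : (p.1.shift p.2.1.2, p.2.1.1) ≠ privEdge p := fun h => hij (Prod.ext_iff.1 h).2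
  have h4 : (p.1, p.2.1.2) ≠ privEdge p := fun h => self_ne_shift' p.1 p.2.1.1 (Prod.ext_iff.1 h).1
  unfold plaquetteHolonomy
  rw [update_of_ne h1, update_of_ne h3, update_of_ne h4, show (p.1.shift p.2.1.1, p.2.1.2) = privEdge p from rfl,
    update_self, mul_assoc]

/-- **One Haar integration.**  If `P` is continuous and does not read the private link of `p`, then
`∫ f_c(U_p) · P dU = ∫ P dU` — for EVERY real coefficient vector `c` (`∫ f_c dHaar = 1` and two-sided invariance of the
Haar probability on `SU(2)`). -/
theorem integral_plaqFn_hol_mul (J : ℕ) (c : ℕ → ℝ) (p : Plaquette d L) {P : GaugeConfig d L SU2 → ℝ}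
    (hP : ∀ W g, P (update W (privEdge p) g) = P W) (hPc : Continuous P) :
    ∫ W, plaqFn J c (plaquetteHolonomy W p.1 p.2.1.1 p.2.1.2) * P W ∂(Measure.pi fun _ : Edge d L => haarProbability SU2) =
      ∫ W, P W ∂(Measure.pi fun _ : Edge d L => haarProbability SU2) := by
  have hint : Integrable (fun W : GaugeConfig d L SU2 => plaqFn J c (plaquetteHolonomy W p.1 p.2.1.1 p.2.1.2) * P W)
      (Measure.pi fun _ : Edge d L => haarProbability SU2) :=
    integrable_pi_su2_of_continuous (((continuous_plaqFn' J c).comp (continuous_hol p)).mul hPc)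
  rw [integral_pi_eq_integral_update (haarProbability SU2) (privEdge p) hint]
  refine integral_congr_ae (ae_of_all _ fun W => ?_)
  have hfun : (fun g : SU2 => plaqFn J c (plaquetteHolonomy (update W (privEdge p) g) p.1 p.2.1.1 p.2.1.2) *
      P (update W (privEdge p) g)) =
      fun g : SU2 => plaqFn J c (W (p.1, p.2.1.1) * g * ((W (p.1.shift p.2.1.2, p.2.1.1))⁻¹ * (W (p.1, p.2.1.2))⁻¹)) * P W := by
    funext g
    rw [hP, plaquetteHolonomy_update_privEdge]
  simp only [hfun]
  rw [integral_mul_const]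
  have hleft := integral_mul_left_eq_self (μ := haarProbability SU2)
    (fun g : SU2 => plaqFn J c (g * ((W (p.1.shift p.2.1.2, p.2.1.1))⁻¹ * (W (p.1, p.2.1.2))⁻¹))) (W (p.1, p.2.1.1))
  have hright := integral_mul_right_eq_self (μ := haarProbability SU2) (fun g : SU2 => plaqFn J c g)
    ((W (p.1.shift p.2.1.2, p.2.1.1))⁻¹ * (W (p.1, p.2.1.2))⁻¹)
  rw [hleft, hright, integral_plaqFn, one_mul]

/-! ### The forest integrates to one -/

/-- **Every subset of the forest integrates to one**: `∫ ∏_{p ∈ s} f_c(U_p) dU = 1` for `s ⊆ 𝔉` and every `c`. -/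
theorem integral_prod_plaqFn_of_subset_forest (J : ℕ) (c : ℕ → ℝ) {s : Finset (Plaquette d L)}
    (hs : s ⊆ axialForest d L) :
    ∫ W, ∏ p ∈ s, plaqFn J c (plaquetteHolonomy W p.1 p.2.1.1 p.2.1.2) ∂(Measure.pi fun _ : Edge d L => haarProbability SU2) = 1 := by
  revert hs
  refine Finset.induction_on_min_value (motive := fun s => s ⊆ axialForest d L →
      ∫ W, ∏ p ∈ s, plaqFn J c (plaquetteHolonomy W p.1 p.2.1.1 p.2.1.2)
        ∂(Measure.pi fun _ : Edge d L => haarProbability SU2) = 1) forestRank s ?_ ?_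
  · intro _
    simp
  · intro a s ha hmin ih hsub
    have haF : a ∈ axialForest d L := hsub (mem_insert_self a s)
    have hsF : s ⊆ axialForest d L := fun q hq => hsub (mem_insert_of_mem hq)
    simp_rw [prod_insert ha]
    rw [integral_plaqFn_hol_mul J c a (P := fun W => ∏ p ∈ s, plaqFn J c (plaquetteHolonomy W p.1 p.2.1.1 p.2.1.2)) ?_ ?_]
    · exact ih hsF
    · intro W g
      refine prod_congr rfl fun q hq => ?_
      rw [plaquetteHolonomy_update_of_notMem]
      intro hmem
      have hqa : q ≠ a := fun h => ha (h ▸ hq)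
      exact absurd (hmin q hq) (not_le.2 (forestRank_lt_of_privEdge_mem haF (hsF hq) hqa hmem))
    · exact continuous_finsetProd _ fun q _ => (continuous_plaqFn' J c).comp (continuous_hol q)

/-- **The axial-gauge forest integrates to one**: `∫ ∏_{p ∈ 𝔉} f_c(U_p) dU = 1` for every coefficient vector `c`. -/
theorem integral_prod_axialForest (J : ℕ) (c : ℕ → ℝ) :
    ∫ W, ∏ p ∈ axialForest d L, plaqFn J c (plaquetteHolonomy W p.1 p.2.1.1 p.2.1.2)
      ∂(Measure.pi fun _ : Edge d L => haarProbability SU2) = 1 :=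
  integral_prod_plaqFn_of_subset_forest J c Subset.rfl

/-! ### The sup bound with the forest removed -/

omit [Fact (1 < L)] in
/-- The forest is a subset of all plaquettes (cardinalities). -/
theorem card_axialForest_le : (axialForest d L).card ≤ Fintype.card (Plaquette d L) :=
  card_le_univ _

/-- **Sup bound on the positivity domain**: for `c_j ≥ 0` with `f_c ≥ 0` pointwise,
`Z_Λ({c_j}) ≤ [1 + Σ_j d_j² c_j]^{#plaquettes - #𝔉}` — the forest's plaquette functions integrate to one, the
others are bounded by `f_c(1) = 1 + Σ_j d_j² c_j`. -/
theorem torusZ_le_pow_card_sub_card_forest (J : ℕ) {c : ℕ → ℝ} (hc : ∀ n, 1 ≤ n → 0 ≤ c n)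
    (hf : ∀ g : SU2, 0 ≤ plaqFn J c g) :
    torusZ d L J c ≤ (1 + ∑ n ∈ Icc 1 J, ((n : ℝ) + 1) ^ 2 * c n) ^
      (Fintype.card (Plaquette d L) - (axialForest d L).card) := by
  set M : ℝ := 1 + ∑ n ∈ Icc 1 J, ((n : ℝ) + 1) ^ 2 * c n with hM_def
  have hM : ∀ g : SU2, plaqFn J c g ≤ M := fun g => (le_abs_self _).trans (abs_plaqFn_le J hc g)
  set F : Finset (Plaquette d L) := axialForest d L with hF_def
  have hcont : ∀ q : Plaquette d L,
      Continuous fun W : GaugeConfig d L SU2 => plaqFn J c (plaquetteHolonomy W q.1 q.2.1.1 q.2.1.2) :=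
    fun q => (continuous_plaqFn' J c).comp (continuous_hol q)
  have hsplit : ∀ W : GaugeConfig d L SU2,
      ∏ p : Plaquette d L, plaqFn J c (plaquetteHolonomy W p.1 p.2.1.1 p.2.1.2) =
        (∏ p ∈ F, plaqFn J c (plaquetteHolonomy W p.1 p.2.1.1 p.2.1.2)) *
          ∏ p ∈ univ \ F, plaqFn J c (plaquetteHolonomy W p.1 p.2.1.1 p.2.1.2) := by
    intro W
    rw [mul_comm, prod_sdiff (subset_univ F)]
  have hcard : (univ \ F).card = Fintype.card (Plaquette d L) - F.card := by
    rw [card_sdiff_of_subset (subset_univ F), card_univ]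
  unfold torusZ
  simp_rw [hsplit]
  calc ∫ W, (∏ p ∈ F, plaqFn J c (plaquetteHolonomy W p.1 p.2.1.1 p.2.1.2)) *
          ∏ p ∈ univ \ F, plaqFn J c (plaquetteHolonomy W p.1 p.2.1.1 p.2.1.2)
          ∂(Measure.pi fun _ : Edge d L => haarProbability SU2)
      ≤ ∫ W, (∏ p ∈ F, plaqFn J c (plaquetteHolonomy W p.1 p.2.1.1 p.2.1.2)) * M ^ (univ \ F).card
          ∂(Measure.pi fun _ : Edge d L => haarProbability SU2) := by
        refine integral_mono (integrable_pi_su2_of_continuous ?_) (integrable_pi_su2_of_continuous ?_) fun W => ?_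
        · exact (continuous_finsetProd _ fun q _ => hcont q).mul (continuous_finsetProd _ fun q _ => hcont q)
        · exact (continuous_finsetProd _ fun q _ => hcont q).mul continuous_const
        · refine mul_le_mul_of_nonneg_left ?_ (prod_nonneg fun q _ => hf _)
          rw [← prod_const]
          exact prod_le_prod (fun q _ => hf _) fun q _ => hM _
    _ = M ^ (Fintype.card (Plaquette d L) - F.card) := by
        rw [integral_mul_const, integral_prod_axialForest, one_mul, hcard]

end Peel

end Summit.Ventures.YMGap.Census

end
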